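import Summits.AtomisticToContinuum.Crystallization.Theses.MinMeanCycleStackingLock

/-!
# Route `MinMeanCycleStackingLock`, item stmt-AtomisticToContinuum-12026 `Assembly`

The assembly of route `AtomisticToContinuum/Crystallization/MinMeanCycleStackingLock`:

`LockedBoxMinimiser → LockedStackingOnBox → PeriodicReductionToBarlow → BarlowEnergyIdentification →
HaggEnergyPeriodic → CrysEnergyLimit → BulkDefectVanishBased → BasedDefectVanishCrystallizes →
LennardJonesMinimalDistance → Crystallization`.

Pure logic: `LockedBoxMinimiser` applied to the target `LockedStackingOnBox`, the reduction
`PeriodicReductionToBarlow`, the layer bookkeeping `BarlowEnergyIdentification` and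
`HaggEnergyPeriodic` gives a periodic configuration `P` at which the periodic infimum of the
Lennard-Jones energy per particle is attained (`IsLeast`); by `IsLeast.csInf_eq` the `⨅` in
`CrysEnergyLimit` is `e(P)`, which is the `Tendsto` clause of `HasPeriodicGroundStateEnergy`;
`BasedDefectVanishCrystallizes` applied to `BulkDefectVanishBased` and the minimal-distance fact is
`IsCrystallizing lennardJones 3`; the pair is `Crystallization`.
-/

namespace Summit.AtomisticToContinuum.Crystallization.Theorems

open Summit.AtomisticToContinuum.Crystallization.Theses.MinMeanCycleStackingLock

/-- **Item stmt-AtomisticToContinuum-12026** (`Assembly`, route `MinMeanCycleStackingLock`):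
`LockedBoxMinimiser → LockedStackingOnBox → PeriodicReductionToBarlow → BarlowEnergyIdentification →
HaggEnergyPeriodic → CrysEnergyLimit → BulkDefectVanishBased → BasedDefectVanishCrystallizes →
LennardJonesMinimalDistance → Crystallization`.  The analysis glue gives the attained periodic
minimum `P`, `IsLeast.csInf_eq` identifies the `⨅` in `CrysEnergyLimit` with `e(P)`, and the soft
assembly lemma with the minimal-distance fact gives positional crystallization. -/
theorem minMeanCycleStackingLock_assembly_proof :
    Summit.AtomisticToContinuum.Crystallization.Theses.MinMeanCycleStackingLock.Assembly := by
  unfold Summit.AtomisticToContinuum.Crystallization.Theses.MinMeanCycleStackingLock.Assembly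
  intro hLockedBoxMinimiser hLockedStackingOnBox hPeriodicReductionToBarlow
    hBarlowEnergyIdentification hHaggEnergyPeriodic hCrysEnergyLimit hBulkDefectVanishBased
    hBasedDefectVanishCrystallizes hMinDist
  -- energetic half: the attained periodic minimum `P`
  obtain ⟨P, hP⟩ :=
    hLockedBoxMinimiser hLockedStackingOnBox hPeriodicReductionToBarlow hBarlowEnergyIdentification
      hHaggEnergyPeriodic
  -- `⨅_Q e(Q) = e(P)` since the minimum is attained at `P`
  have hinf : (⨅ Q : Literature.MathematicalPhysics.StatisticalMechanics.PeriodicConfiguration 3,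
      Q.energyPerParticle Literature.MathematicalPhysics.StatisticalMechanics.lennardJones) =
      P.energyPerParticle Literature.MathematicalPhysics.StatisticalMechanics.lennardJones :=
    hP.csInf_eq
  -- `CrysEnergyLimit`: `E(N)/N → ⨅_Q e(Q)`, rewritten to `e(P)`
  have hlim : Filter.Tendsto
      (fun N : ℕ => Literature.MathematicalPhysics.StatisticalMechanics.groundStateEnergy
        Literature.MathematicalPhysics.StatisticalMechanics.lennardJones 3 N / N) Filter.atTop
      (nhds (P.energyPerParticle Literature.MathematicalPhysics.StatisticalMechanics.lennardJones)) := by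
    have h0 : CrysEnergyLimit := hCrysEnergyLimit
    unfold CrysEnergyLimit at h0
    rw [hinf] at h0
    exact h0
  -- positional half: the based hinge + its soft assembly lemma + minimal distance
  have hpos : Literature.MathematicalPhysics.StatisticalMechanics.IsCrystallizing
      Literature.MathematicalPhysics.StatisticalMechanics.lennardJones 3 :=
    hBasedDefectVanishCrystallizes hBulkDefectVanishBased hMinDist
  -- `Crystallization = HasPeriodicGroundStateEnergy lennardJones 3 ∧ IsCrystallizing lennardJones 3`
  exact ⟨⟨P, hP, hlim⟩, hpos⟩

end Summit.AtomisticToContinuum.Crystallization.Theorems
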